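import Summits.ValiantsHypothesis.ValiantsHypothesis.Theorems.GrenetZeonDualUnipotentThreeHalvesLongMassRankR
import Summits.ValiantsHypothesis.ValiantsHypothesis.Theorems.GrenetZeonDualUnipotentThreeHalvesLongMassRankRow
import Literature.LinearAlgebra.MeshulamBoundedRank

/-!
# `GrenetZeon.DualUnipotentThreeHalves` (stmt-ValiantsHypothesis-24318), line `slow_core`, stub `stub_longMassSlowLawInv` ((c)):
# REACH OF THE RANK CERTIFICATES — they beat FREEZE only for constituents of size `b > n`

Honesty row for the rank-`r` window row ✓ `LongMassRankR.relCert_of_rank` (p817721/p817776): its price is `n·r + codim K` for a direction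
space `K` all of whose members have coefficient-rank `≤ r`.  By MESHULAM's theorem (✓ `Literature.LinearAlgebra.Meshulam1985_exists_rank_gt_holds`,
Flanders' bound over any field: a linear space of `m × m` matrices of rank `≤ r` has dimension `≤ r·m`) the image `lin(K)` of such a `K` under the
linear-part map has dimension `≤ r·m`, so by rank–nullity `codim K ≥ μ − r·m`, `μ = mass N` the rank of the linear part (`mass_le_of_rank_le`).
Hence the rank price is `≥ μ + r·(n − m)`, which for `m ≤ n` is at least the FREEZE price `μ` of ✓ `Ceilings.relCert_freeze`
(`mass_le_rankPrice_of_le`): **on constituents of size `b ≤ n` the rank instrument certifies nothing that freezing does not**; its live range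
inside (c)'s box `2c√n < b < n^{3/2}/c` is the upper part `n < b < n^{3/2}/c`, where a rank-`r` direction space can save up to `r·(b − n)` over
freezing.  Honest framing: calibration of an instrument (`--supports stmt-ValiantsHypothesis-24318`); NOT progress on (c) `SlowCore.LongMassSlowLawInv`;
(c), S3, 24318, 8062, VP ≠ VNP OPEN / NOT proved.  No sorry, no definitions, no new named facts (Meshulam's theorem is PROVED in the tree).
-/

-- single-conjunct layout: Sub = Summit, duplicated namespace component intended (the name is mandated)
set_option linter.dupNamespace false
set_option autoImplicit false

noncomputable section

namespace Summit.ValiantsHypothesis.ValiantsHypothesis.Theorems.GrenetZeon.LongMassRankR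

open MvPolynomial Matrix
open Summit.ValiantsHypothesis.ValiantsHypothesis.Cruxes.TwoDimCoefficients.DimTwoCases (AffMat IsAffine)
open Summit.ValiantsHypothesis.ValiantsHypothesis.Theorems.GrenetZeon.SlowCore
  (Ledger RelCert linEntry freezeSpace linFun_apply finrank_dir_le)
open Summit.ValiantsHypothesis.ValiantsHypothesis.Theorems.GrenetZeon.Ceilings (mass relCert_freeze)
open Summit.ValiantsHypothesis.ValiantsHypothesis.Theorems.GrenetZeon.RankRow (linMap linMap_apply)
open Summit.ValiantsHypothesis.ValiantsHypothesis.Theorems.GrenetZeon.ResolventFlag (linMat)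

variable {n m : ℕ}

/-- The kernel of the linear-part map is the freezing space of all positions. [this file] -/
theorem ker_linMap_eq_freezeSpace (N : AffMat n m) :
    LinearMap.ker (linMap N) = freezeSpace N (Finset.univ : Finset (Fin m × Fin m)) := by
  ext v
  rw [LinearMap.mem_ker, freezeSpace, LinearMap.mem_ker, linMap_apply]
  constructor
  · intro h
    funext r
    rw [LinearMap.pi_apply, linFun_apply, Pi.zero_apply]
    have h1 := congrFun (congrFun h r.1.1) r.1.2
    rwa [linMat, Matrix.of_apply, Matrix.zero_apply] at h1
  · intro h
    refine Matrix.ext fun i j => ?_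
    have h1 := congrFun h ⟨(i, j), Finset.mem_univ _⟩
    rw [LinearMap.pi_apply, linFun_apply, Pi.zero_apply] at h1
    rw [linMat, Matrix.of_apply, Matrix.zero_apply]
    exact h1

/-- ★ **MESHULAM BOUND ON RANK CERTIFICATES.**  If every direction in `K` has linear coefficient matrix of rank `≤ r`, then
`mass N ≤ r·m + codim K`: the image `lin(K)` is a space of `m × m` matrices of rank `≤ r`, of dimension `≤ r·m` (Meshulam 1985 / Flanders),
and `ker lin|_K ≤ ker lin = freezeSpace`. [this file; cite: Meshulam1985 Thm. 2 via ✓ `Literature.LinearAlgebra.finrank_le_mul_of_forall_rank_le`] -/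
theorem mass_le_of_rank_le (N : AffMat n m) (K : Submodule ℂ (Fin n × Fin n → ℂ)) (r : ℕ)
    (hK : ∀ v ∈ K, (linMat N v).rank ≤ r) :
    mass N ≤ r * m + (n * n - Module.finrank ℂ K) := by
  set f : ↥K →ₗ[ℂ] Matrix (Fin m) (Fin m) ℂ := (linMap N).domRestrict K with hf
  have hrn := LinearMap.finrank_range_add_finrank_ker f
  have hrange : Module.finrank ℂ (LinearMap.range f) ≤ r * m := by
    rw [hf, LinearMap.range_domRestrict]
    refine Literature.LinearAlgebra.finrank_le_mul_of_forall_rank_le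
      (Literature.LinearAlgebra.Meshulam1985_exists_rank_gt_holds ℂ) _ fun A hA => ?_
    obtain ⟨v, hv, rfl⟩ := Submodule.mem_map.mp hA
    rw [linMap_apply]
    exact hK v hv
  have hker : Module.finrank ℂ (LinearMap.ker f) ≤
      Module.finrank ℂ (freezeSpace N (Finset.univ : Finset (Fin m × Fin m))) := by
    rw [hf, LinearMap.ker_domRestrict, ← Submodule.finrank_map_subtype_eq K]
    refine Submodule.finrank_mono ?_
    rw [Submodule.map_comap_subtype, ker_linMap_eq_freezeSpace]
    exact inf_le_right
  have hF := finrank_dir_le n (freezeSpace N (Finset.univ : Finset (Fin m × Fin m)))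
  have hKle := finrank_dir_le n K
  rw [mass]
  omega

/-- ★ **REACH: for `m ≤ n` the rank price never beats the FREEZE price.**  With `K`, `r` as in ✓ `relCert_of_rank`, the price
`n·r + codim K` is `≥ mass N` whenever `m ≤ n` — and `RelCert n m N (mass N)` is already ✓ `Ceilings.relCert_freeze`.  So the rank instrument is
informative only on constituents of size `b > n` (upper part of (c)'s live box). [this file] -/
theorem mass_le_rankPrice_of_le (N : AffMat n m) (K : Submodule ℂ (Fin n × Fin n → ℂ)) (r : ℕ)
    (hK : ∀ v ∈ K, (linMat N v).rank ≤ r) (hmn : m ≤ n) :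
    mass N ≤ n * r + (n * n - Module.finrank ℂ K) := by
  have h := mass_le_of_rank_le N K r hK
  have h2 : r * m ≤ n * r := by rw [mul_comm n r]; exact Nat.mul_le_mul_left r hmn
  omega

/-- The positive side restated next to it: for `m ≤ n` FREEZE is at least as cheap, so the better of the two certificates is
`RelCert n m N (mass N)`. [this file] -/
theorem relCert_min_freeze_rank_of_le (N : AffMat n m) (hN : IsAffine N) (K : Submodule ℂ (Fin n × Fin n → ℂ)) (r : ℕ)
    (hK : ∀ v ∈ K, (linMat N v).rank ≤ r) (hmn : m ≤ n) :
    RelCert n m N (min (mass N) (n * r + (n * n - Module.finrank ℂ K))) := by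
  rw [min_eq_left (mass_le_rankPrice_of_le N K r hK hmn)]
  exact relCert_freeze N hN

end Summit.ValiantsHypothesis.ValiantsHypothesis.Theorems.GrenetZeon.LongMassRankR

end
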